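import Literature.NumberTheory.GaloisRepresentations.LubinTateColemanCoordCoinvariantDivisionTwo
import Literature.NumberTheory.GaloisRepresentations.LubinTateColemanCoordMomentsCoinvariantTwo
import HarnessLib

/-!
# Non-vanishing of the divided element `L_ε = μ(𝔣)_ε` on the series side: **`L_ε ≠ 0 ↔ φ_ε(x a₁) ≠ 0`**, `φ_ε(x) ≠ 0 ↔ x ∉ (σ_{−1} − ε)M`,
# both parities cannot die on a non-zero element, and at one level **`mom_k(x) ≠ 0 ⟹ φ_{(−1)^{k+1}}(x) ≠ 0`** — so `L_ε ≠ 0` follows from ONE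
# non-vanishing Coates–Wiles moment of parity `ε` of ONE member of the family

De Shalit, *Iwasawa theory of elliptic curves with complex multiplication* (1987), II §4.12 (31)–(33), III §1.4 Cor. 1.5: the measure `μ(𝔣)` is
not a zero-divisor because its integrals against `κ^k` are (Euler factors times) non-zero `L`-values.  In the Coleman lane the local (c)-identity
`char_Λ ((N / Col 𝒞̄)_ε) = (L_ε)` (`Theorems/PrintCf2RubinValueTwoColemanCoinvariantChar{Closure,Generated,Principal}`) carries `L_ε ≠ 0` as a
NAMED INPUT, `L_ε` being the divided element of `existsUnique_colemanDeltaCoinvFun_eq_mul` (`φ_ε(x c) = (t_{v c} − N c)·L_ε` for every `c`).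
THIS file reduces that input to the family (everything PROVED, 0 sorry, no definitions, no named facts):

* §1 (generic rank-two frame `M = R·b₀ ⊕ R·b₁`, swap `τ`, `φ_ε = b₀* + ε b₁*`): `deltaCoinvFun_eq_zero_iff_mem_range` (`φ_ε(m) = 0 ↔ m ∈ (τ − ε)M`),
  ★ `eq_zero_of_deltaCoinvFun_one_eq_zero_of_neg_one_eq_zero` (if `2` is regular on `R`: `φ₁(m) = φ₋₁(m) = 0 ⟹ m = 0`),
  `deltaCoinvFun_one_ne_zero_or_neg_one_ne_zero` (`m ≠ 0 ⟹ φ₁(m) ≠ 0 ∨ φ₋₁(m) ≠ 0`);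
* §2 (Coleman module over any base `S`): `colemanDeltaCoinvFun_eq_zero_iff_mem_range`; ★ `ne_zero_of_colemanDeltaCoinvFun_ne_zero_of_forall_eq_mul`
  (**`φ_ε(x c₀) ≠ 0 ⟹ L ≠ 0`**); ★★ `ne_zero_iff_colemanDeltaCoinvFun_ne_zero_of_forall_eq_mul` (**`L ≠ 0 ↔ φ_ε(x a₁) ≠ 0`** at the index `a₁`
  with `v a₁ = γ`, `N a₁ = C n₁`, `n₁ ≡ 1 (mod π)`: its factor `t_γ − C n₁ = T − C(n₁ − 1)` is a non-zero-divisor);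
* §3 (one level, `S = 𝒪_E`): ★★ `colemanDeltaCoinvFun_ne_zero_of_coordMoment_ne_zero` (**`mom_k(x) ≠ 0 ⟹ φ_{(−1)^{k+1}}(x) ≠ 0`**, from
  `mom_k(x) = φ_ε(x)(a_k)·mom_k(1)`), ★★ `ne_zero_of_coordMoment_ne_zero_of_forall_eq_mul` (**one non-zero moment of parity `ε` of one `x c₀`
  ⟹ `L_ε ≠ 0`**) and its Coates–Wiles reading for `x c = ofPS (r_{β c})` (`coordMoment_relUnitCoordTwo_eq_coatesWiles`): the analytic input of the
  local (c)-identity at one level is ONE non-vanishing Euler-twisted Coates–Wiles value `δ_k(β_{c₀})` with `(−1)^{k+1} = ε`.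

Cell `bsd-print-cf2`, width seat `bsd-line-cf2c-w7` g14.

## References
* E. de Shalit, *Iwasawa theory of elliptic curves with complex multiplication* (1987), Ch. I §3.1, §3.5 (11); Ch. II §4.12 (31)–(33);
  Ch. III §1.4 Cor. 1.5, §1.8 (14). [deShalit1987]
* J. Coates, A. Wiles, *On the conjecture of Birch and Swinnerton-Dyer*, Invent. Math. 39 (1977), §2. [CoatesWiles1977]
-/

noncomputable section

open PowerSeries

namespace Literature.NumberTheory.GaloisRepresentations

/-! ### §1. Generic: when does `φ_ε` vanish? -/

section DeltaCoinvariantsNonvanishing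

variable {R M : Type*} [CommRing R] [AddCommGroup M] [Module R M]
variable (b : Module.Basis (Fin 2) R M) (ε : R)
variable (τ : M →ₗ[R] M) (hτ0 : τ (b 0) = b 1) (hτ1 : τ (b 1) = b 0) (hε : ε * ε = 1)

include hτ0 hτ1 hε in
/-- **`φ_ε(m) = 0 ↔ m ∈ (τ − ε)M`** (`ker φ_ε = range (τ − ε)`). [cite: deShalit1987, Ch. I §3.1; Ch. III §1.8 (14)] -/
theorem deltaCoinvFun_eq_zero_iff_mem_range (m : M) :
    deltaCoinvFun b ε m = 0 ↔ m ∈ LinearMap.range (τ - ε • LinearMap.id) := by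
  rw [← LinearMap.mem_ker, ker_deltaCoinvFun_eq_range b ε τ hτ0 hτ1 hε]

/-- ★ **Both parities cannot die on a non-zero element**: if `2` is regular on `R` and `φ₁(m) = φ₋₁(m) = 0` then `m = 0`
(`a + c = 0 = a − c ⟹ 2a = 0`). [cite: deShalit1987, Ch. I §3.1] -/
theorem eq_zero_of_deltaCoinvFun_one_eq_zero_of_neg_one_eq_zero (h2 : ∀ r : R, 2 * r = 0 → r = 0) {m : M}
    (h₁ : deltaCoinvFun b 1 m = 0) (hneg : deltaCoinvFun b (-1) m = 0) : m = 0 := by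
  rw [deltaCoinvFun_apply, one_mul] at h₁
  rw [deltaCoinvFun_apply, neg_one_mul] at hneg
  have ha : b.repr m 0 = 0 := h2 _ (by linear_combination h₁ + hneg)
  have hc : b.repr m 1 = 0 := by rw [ha, zero_add] at h₁; exact h₁
  refine b.ext_elem fun i => ?_
  fin_cases i
  · simpa using ha
  · simpa using hc

/-- **`m ≠ 0 ⟹ φ₁(m) ≠ 0 ∨ φ₋₁(m) ≠ 0`** (`2` regular on `R`). [cite: deShalit1987, Ch. I §3.1] -/
theorem deltaCoinvFun_one_ne_zero_or_neg_one_ne_zero (h2 : ∀ r : R, 2 * r = 0 → r = 0) {m : M} (hm : m ≠ 0) :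
    deltaCoinvFun b 1 m ≠ 0 ∨ deltaCoinvFun b (-1) m ≠ 0 := by
  by_contra h
  rw [not_or, not_ne_iff, not_ne_iff] at h
  exact hm (eq_zero_of_deltaCoinvFun_one_eq_zero_of_neg_one_eq_zero b h2 h.1 h.2)

/-- **A divided element is non-zero as soon as one dividend is**: `f c = t c · L` for all `c` and `f c₀ ≠ 0` give `L ≠ 0`.
[cite: deShalit1987, Ch. II §4.12 (33)] -/
theorem ne_zero_of_apply_ne_zero_of_forall_eq_mul {I : Type*} {f t : I → R} {L : R} (h : ∀ c, f c = t c * L) {c₀ : I} (hc₀ : f c₀ ≠ 0) :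
    L ≠ 0 := fun hL => hc₀ (by rw [h, hL, mul_zero])

/-- **Conversely at a non-zero-divisor factor**: `f c = t c · L` for all `c` and `t a₁` a non-zero-divisor give `L ≠ 0 ↔ f a₁ ≠ 0`.
[cite: deShalit1987, Ch. II §4.12 (32)–(33)] -/
theorem ne_zero_iff_apply_ne_zero_of_forall_eq_mul {I : Type*} {f t : I → R} {L : R} (h : ∀ c, f c = t c * L) {a₁ : I}
    (ha₁ : t a₁ ∈ nonZeroDivisors R) : L ≠ 0 ↔ f a₁ ≠ 0 := by
  refine ⟨fun hL hf => hL ?_, fun hf => ne_zero_of_apply_ne_zero_of_forall_eq_mul h hf⟩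
  rw [h] at hf
  exact (mul_left_mem_nonZeroDivisors_eq_zero_iff ha₁).mp hf

end DeltaCoinvariantsNonvanishing

/-! ### §2. The Coleman coordinate module over any base `S` -/

section ColemanNonvanishing

open GaloisRepresentations.IsNonarchimedeanLocalField LubinTate ValuativeRel

variable {F : Type} [Field F] [ValuativeRel F] [TopologicalSpace F] [IsNonarchimedeanLocalField F]

attribute [local instance] ltNormUniformSpace ltNormIsUniformAddGroup rk1 nF nE fintypeResidueField

variable {π : 𝒪[F]} (hπ : (valuation F).IsUniformizer (π : F)) (hq : residueFieldCard F = 2)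
variable {S : Type*} [CommRing S] (ι : LTCoeff F →+* S) [IsAdicComplete (Ideal.span {ι (LTCoeff.of F π)}) S]
variable (u : (LTCoeff F)ˣ) (hu : LTCoeff.of F π = residueFieldCard F * u) (γ : 𝒪[F]ˣ)
variable (hreg : ∀ x : S, ι (LTCoeff.of F π) * x = 0 → x = 0) (w : 𝒪[F]ˣ) (hγ : (γ : 𝒪[F]) = 1 + π ^ 2 * w)
variable (ε : PowerSeries S) (hε : ε * ε = 1)

include hε in
/-- **`φ_ε(x) = 0 ↔ x ∈ (σ_{−1} − ε)M`** on the Coleman coordinate module. [cite: deShalit1987, Ch. I §3.1; Ch. III §1.8 (14)] -/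
theorem colemanDeltaCoinvFun_eq_zero_iff_mem_range (x : ColemanCoordModule hπ hq ι u hu γ) :
    colemanDeltaCoinvFun hπ hq ι u hu γ hreg w hγ ε x = 0 ↔
      x ∈ LinearMap.range (unitTwistₗ hπ hq ι u hu γ (-1) - ε • LinearMap.id) :=
  deltaCoinvFun_eq_zero_iff_mem_range _ ε _ (unitTwistₗ_neg_one_coordBasisDelta_zero hπ hq ι u hu γ hreg w hγ)
    (unitTwistₗ_neg_one_coordBasisDelta_one hπ hq ι u hu γ hreg w hγ) hε x

/-- **Both parities cannot die**: if `2` is regular on `S` then `φ₁(x) = φ₋₁(x) = 0 ⟹ x = 0` (so a non-zero `x` — e.g. `Col β` of a non-trivial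
principal unit family — has `φ_ε(x) ≠ 0` for at least one sign `ε`). [cite: deShalit1987, Ch. I §3.1] -/
theorem eq_zero_of_colemanDeltaCoinvFun_one_eq_zero_of_neg_one_eq_zero (h2 : ∀ s : S, 2 * s = 0 → s = 0)
    {x : ColemanCoordModule hπ hq ι u hu γ} (h₁ : colemanDeltaCoinvFun hπ hq ι u hu γ hreg w hγ 1 x = 0)
    (hneg : colemanDeltaCoinvFun hπ hq ι u hu γ hreg w hγ (-1) x = 0) : x = 0 := by
  refine eq_zero_of_deltaCoinvFun_one_eq_zero_of_neg_one_eq_zero _ (fun r hr => ?_) h₁ hneg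
  ext n
  have h := congrArg (PowerSeries.coeff n) hr
  rw [map_zero, show (2 : PowerSeries S) = PowerSeries.C (2 : S) by rw [map_ofNat], PowerSeries.coeff_C_mul] at h
  rw [map_zero]
  exact h2 _ h

/-- `x ≠ 0 ⟹ φ₁(x) ≠ 0 ∨ φ₋₁(x) ≠ 0` (`2` regular on `S`). [cite: deShalit1987, Ch. I §3.1] -/
theorem colemanDeltaCoinvFun_one_ne_zero_or_neg_one_ne_zero (h2 : ∀ s : S, 2 * s = 0 → s = 0)
    {x : ColemanCoordModule hπ hq ι u hu γ} (hx : x ≠ 0) :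
    colemanDeltaCoinvFun hπ hq ι u hu γ hreg w hγ 1 x ≠ 0 ∨ colemanDeltaCoinvFun hπ hq ι u hu γ hreg w hγ (-1) x ≠ 0 := by
  by_contra h
  rw [not_or, not_ne_iff, not_ne_iff] at h
  exact hx (eq_zero_of_colemanDeltaCoinvFun_one_eq_zero_of_neg_one_eq_zero hπ hq ι u hu γ hreg w hγ h2 h.1 h.2)

variable {I : Type*} (x : I → ColemanCoordModule hπ hq ι u hu γ) (v : I → 𝒪[F]ˣ) (N : I → PowerSeries S) (L : PowerSeries S)
  (hL : ∀ c : I, colemanDeltaCoinvFun hπ hq ι u hu γ hreg w hγ ε (x c) =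
    (colemanDeltaCoinvFun hπ hq ι u hu γ hreg w hγ ε (unitTwistₗ hπ hq ι u hu γ (v c) (TActModule.ofPS _ _ 1)) - N c) * L)

include hL in
/-- ★ **`φ_ε(x c₀) ≠ 0` for one index ⟹ `L_ε ≠ 0`** (the divided element of `existsUnique_colemanDeltaCoinvFun_eq_mul`).
[cite: deShalit1987, Ch. II §4.12 (33); Ch. III §1.4 Cor. 1.5] -/
theorem ne_zero_of_colemanDeltaCoinvFun_ne_zero_of_forall_eq_mul {c₀ : I}
    (hc₀ : colemanDeltaCoinvFun hπ hq ι u hu γ hreg w hγ ε (x c₀) ≠ 0) : L ≠ 0 :=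
  ne_zero_of_apply_ne_zero_of_forall_eq_mul hL hc₀

include hL hε in
/-- Equivalently: `x c₀ ∉ (σ_{−1} − ε)M` for one index ⟹ `L_ε ≠ 0`. [cite: deShalit1987, Ch. II §4.12 (33); Ch. III §1.8 (14)] -/
theorem ne_zero_of_not_mem_range_of_forall_eq_mul {c₀ : I}
    (hc₀ : x c₀ ∉ LinearMap.range (unitTwistₗ hπ hq ι u hu γ (-1) - ε • LinearMap.id)) : L ≠ 0 :=
  ne_zero_of_colemanDeltaCoinvFun_ne_zero_of_forall_eq_mul hπ hq ι u hu γ hreg w hγ ε x v N L hL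
    (fun h => hc₀ ((colemanDeltaCoinvFun_eq_zero_iff_mem_range hπ hq ι u hu γ hreg w hγ ε hε _).mp h))

include hL in
/-- ★★ **`L_ε ≠ 0 ↔ φ_ε(x a₁) ≠ 0`** at the auxiliary index `a₁` (`v a₁ = γ`, `N a₁ = C n₁`, `n₁ ≡ 1 (mod π)`): its factor
`t_γ − C n₁ = T − C(n₁ − 1)` is a non-zero-divisor of `S⟦T⟧`. [cite: deShalit1987, Ch. II §4.12 (32)–(33)] -/
theorem ne_zero_iff_colemanDeltaCoinvFun_ne_zero_of_forall_eq_mul (a₁ : I) (hv₁ : v a₁ = γ) {n₁ : S} (hN₁ : N a₁ = PowerSeries.C n₁)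
    (hn₁ : n₁ - 1 ∈ Ideal.span {ι (LTCoeff.of F π)}) :
    L ≠ 0 ↔ colemanDeltaCoinvFun hπ hq ι u hu γ hreg w hγ ε (x a₁) ≠ 0 := by
  have hd₁ : colemanDeltaCoinvFun hπ hq ι u hu γ hreg w hγ ε
        (unitTwistₗ hπ hq ι u hu γ (v a₁) (TActModule.ofPS _ _ 1)) - N a₁ =
      1 * (PowerSeries.X - PowerSeries.C (n₁ - 1)) := by
    rw [hv₁, hN₁]; exact colemanDeltaCoinvFun_unitTwistₗ_self_one_sub_C hπ hq ι u hu γ hreg w hγ ε n₁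
  exact ne_zero_iff_apply_ne_zero_of_forall_eq_mul hL (mem_nonZeroDivisors_of_eq_unit_mul_X_sub_C' hn₁ isUnit_one hd₁)

include hL hε in
/-- The same with membership: `L_ε ≠ 0 ↔ x a₁ ∉ (σ_{−1} − ε)M`. [cite: deShalit1987, Ch. II §4.12 (32)–(33); Ch. III §1.8 (14)] -/
theorem ne_zero_iff_not_mem_range_of_forall_eq_mul (a₁ : I) (hv₁ : v a₁ = γ) {n₁ : S} (hN₁ : N a₁ = PowerSeries.C n₁)
    (hn₁ : n₁ - 1 ∈ Ideal.span {ι (LTCoeff.of F π)}) :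
    L ≠ 0 ↔ x a₁ ∉ LinearMap.range (unitTwistₗ hπ hq ι u hu γ (-1) - ε • LinearMap.id) := by
  rw [ne_zero_iff_colemanDeltaCoinvFun_ne_zero_of_forall_eq_mul hπ hq ι u hu γ hreg w hγ ε x v N L hL a₁ hv₁ hN₁ hn₁, Ne,
    colemanDeltaCoinvFun_eq_zero_iff_mem_range hπ hq ι u hu γ hreg w hγ ε hε]

end ColemanNonvanishing

/-! ### §3. One level (`S = 𝒪_E`): a non-vanishing moment of parity `ε` forces `L_ε ≠ 0` -/

section MomentsNonvanishing

open GaloisRepresentations.IsNonarchimedeanLocalField LubinTate ValuativeRel Field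

variable {F : Type} [Field F] [ValuativeRel F] [TopologicalSpace F] [IsNonarchimedeanLocalField F]

attribute [local instance] ltNormUniformSpace ltNormIsUniformAddGroup rk1 nF nE fintypeResidueField

variable {π : 𝒪[F]} (hπ : (valuation F).IsUniformizer (π : F))
variable (E : IntermediateField F (AlgebraicClosure F)) [FiniteDimensional F E]
variable (hq : residueFieldCard F = 2) (u : (LTCoeff F)ˣ) (hu : LTCoeff.of F π = residueFieldCard F * u) (γ : 𝒪[F]ˣ)
variable [IsAdicComplete (Ideal.span {algebraMap (LTCoeff F) (unitBall E) (LTCoeff.of F π)}) (unitBall E)]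
variable (hreg : ∀ x : unitBall E, algebraMap (LTCoeff F) (unitBall E) (LTCoeff.of F π) * x = 0 → x = 0)
  (w : 𝒪[F]ˣ) (hγ : (γ : 𝒪[F]) = 1 + π ^ 2 * w)

include hu in
/-- ★★ **`mom_k(x) ≠ 0 ⟹ φ_{(−1)^{k+1}}(x) ≠ 0`** (`mom_k(x) = φ_ε(x)(a_k)·mom_k(1)`). [cite: deShalit1987, Ch. I §3.5 (11); Ch. III §1.8 (14)] -/
theorem colemanDeltaCoinvFun_ne_zero_of_coordMoment_ne_zero (k : ℕ)
    (x : ColemanCoordModule hπ hq (algebraMap (LTCoeff F) (unitBall E)) u hu γ) (hx : coordMoment hπ E u k (TActModule.toPS x) ≠ 0) :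
    colemanDeltaCoinvFun hπ hq (algebraMap (LTCoeff F) (unitBall E)) u hu γ hreg w hγ ((-1) ^ (k + 1)) x ≠ 0 := by
  intro h
  refine hx ?_
  rw [coordMoment_eq_tEval_colemanDeltaCoinvFun hπ E hq u hu γ hreg w hγ k x, h, ← tEvalHom_apply, map_zero, zero_mul]

variable {I : Type*} (x : I → ColemanCoordModule hπ hq (algebraMap (LTCoeff F) (unitBall E)) u hu γ) (v : I → 𝒪[F]ˣ)
  (N : I → PowerSeries (unitBall E)) (ε L : PowerSeries (unitBall E))
  (hL : ∀ c : I, colemanDeltaCoinvFun hπ hq (algebraMap (LTCoeff F) (unitBall E)) u hu γ hreg w hγ ε (x c) =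
    (colemanDeltaCoinvFun hπ hq (algebraMap (LTCoeff F) (unitBall E)) u hu γ hreg w hγ ε
      (unitTwistₗ hπ hq (algebraMap (LTCoeff F) (unitBall E)) u hu γ (v c) (TActModule.ofPS _ _ 1)) - N c) * L)

include hu hL in
/-- ★★ **ONE non-zero moment of parity `ε` of ONE member of the family ⟹ `L_ε ≠ 0`**: if `(−1)^{k+1} = ε` and `mom_k(x c₀) ≠ 0` then the divided
element is non-zero. [cite: deShalit1987, Ch. II §4.12 (31)–(33); Ch. III §1.4 Cor. 1.5] -/
theorem ne_zero_of_coordMoment_ne_zero_of_forall_eq_mul {k : ℕ} (hk : ((-1 : PowerSeries (unitBall E))) ^ (k + 1) = ε) {c₀ : I}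
    (hc₀ : coordMoment hπ E u k (TActModule.toPS (x c₀)) ≠ 0) : L ≠ 0 :=
  ne_zero_of_colemanDeltaCoinvFun_ne_zero_of_forall_eq_mul hπ hq (algebraMap (LTCoeff F) (unitBall E)) u hu γ hreg w hγ ε x v N L hL
    (hk ▸ colemanDeltaCoinvFun_ne_zero_of_coordMoment_ne_zero hπ E hq u hu γ hreg w hγ k (x c₀) hc₀)

variable [Normal F E] [IsGalois F E] (hE : E ≤ maxUnramified F) {σ₀ : absoluteGaloisGroup F} (hσ₀ : IsAbsArithFrob σ₀)

include hu hL in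
/-- ★★ **Coates–Wiles reading**: for the coordinates `x c = ofPS (r_{β c})` of units `β c ∈ 𝒰(E·K_π^∞)`, ONE non-vanishing Euler-twisted
Coates–Wiles value `[X⁰]D_E^[k](δ_E g_{β c₀}) − uπ^k φ([X⁰]D_E^[k](δ_E g_{β c₀}))` with `(−1)^{k+1} = ε` gives `L_ε ≠ 0` — the analytic input of the local
(c)-identity at one level. [cite: deShalit1987, Ch. I §3.5 (11); Ch. II §4.7 (17), §4.12 (31)] [cite: CoatesWiles1977, §2] -/
theorem ne_zero_of_coatesWiles_ne_zero_of_forall_eq_mul (β : I → RelNormCoherentUnits hπ E)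
    (hx : ∀ c, TActModule.toPS (x c) = relUnitCoordTwo hπ E hq hE hσ₀ u hu (β c))
    {k : ℕ} (hk : ((-1 : PowerSeries (unitBall E))) ^ (k + 1) = ε) {c₀ : I}
    (hc₀ : PowerSeries.constantCoeff ((fun g : PowerSeries (unitBall E) =>
          (invDiff (isLTRing_LTCoeff hπ) (isLTSeries_LTCoeff π)).map (algebraMap (LTCoeff F) (unitBall E)) *
            d⁄dX (unitBall E) g)^[k] (relLogDerivSeries hπ E hq hE hσ₀ (β c₀))) -
        algebraMap (LTCoeff F) (unitBall E) (u : LTCoeff F) * algebraMap (LTCoeff F) (unitBall E) (LTCoeff.of F π) ^ k *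
          (frobUnitBall E σ₀ : unitBall E →+* unitBall E)
            (PowerSeries.constantCoeff ((fun g : PowerSeries (unitBall E) =>
              (invDiff (isLTRing_LTCoeff hπ) (isLTSeries_LTCoeff π)).map (algebraMap (LTCoeff F) (unitBall E)) *
                d⁄dX (unitBall E) g)^[k] (relLogDerivSeries hπ E hq hE hσ₀ (β c₀)))) ≠ 0) : L ≠ 0 := by
  refine ne_zero_of_coordMoment_ne_zero_of_forall_eq_mul hπ E hq u hu γ hreg w hγ x v N ε L hL hk (c₀ := c₀) ?_
  rw [hx, coordMoment_relUnitCoordTwo_eq_coatesWiles hπ E hq hE hσ₀ u hu]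
  exact hc₀

end MomentsNonvanishing

end Literature.NumberTheory.GaloisRepresentations
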